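/-
Copyright (c) 2026 the pub-hodgecm-mathlib formalisation cell (harness21).  Prover seat hodgecm-mathlib-LH4-p04 (g4), Track A «(D-RAM) FOUR-FRAME», unit U2H, the census leaf
(ρ2b′-X) — payer LH4-p14 (g4) deal 05:51:49Z (T5c-O∕E) «THE NO-TRANSLATOR CLASSES OF THE RamM CENSUS» (sequel of LH4-p06 (g4)'s ★ p857385 `QuadraticOrderLevelCountsRamified`;
the letters `hnM` ∕ the `k = −1` row of `hnP` of this seat's ★ p857711 `F0P3cDyRamToricCensusSumRamM`).  2026-09-04.
-/
import Literature.NumberTheory.LocalFields.QuadraticOrderLevelCountsRamified   -- ★ p857385 (LH4-p06 (g4)): the translator counts; brings ★ p857372 (generator sets), ★ F1 p857298 (cosets), ★ p857299 (twist classes)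
import HarnessLib

/-!
# The u-free LEVEL COUNTS of the toric census when `M ∕ E` is RAMIFIED, for the classes WITHOUT an exact translator:
# the APPROXIMATE translation lemma and the five counts (`[B:H] − [B′:H] ∣ [B:H] ∣ 0`)
(Flicker 1998 p. 84 (Mars); Serre, *Local Fields* Ch. V §1–§3; Jacobowitz 1962 §4)

Topic `NumberTheory/LocalFields`; namespace `Literature.NumberTheory.LocalFields.QuadraticOrder` (= ★ T4, ★ F1 p857298, ★ p857299, ★ p857372∕p857385).  THEOREMS ONLY (no
definition, no instance, no notation, no named fact, no `sorry`); kernel lane `--supports stmt-HodgeConjecture-24833` (count-neutral).  Cell `pub/hodgecm-mathlib` (D-0151), crux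
H413, Track A, unit U2H, leaf (ρ2b′-X): the RamM census (`M∕E` ramified, uniformiser `α` with `|α − ρα| = exp(−d_ρ)`, conductor `ϖE^j`, `|ϖE| = exp(−2)`) counts the order lattices
`x₀·𝒪_j` whose dual generator is integral, Gram-primitive and of level `|ϖE|^a`; ★ p857372 writes their generators as `α^{k₀}·{ω : |ω| = 1, |1 + η′·t(ω)| = X}` (`η′ = (ρh∕h)·t(α^{k₀})`,
`t(ω) = ρ(ωΘω)∕(ωΘω)`, `X = exp(2a − 2j − d_ρ)`), and ★ p857385 counts them GIVEN AN EXACT TRANSLATOR `η′·t(ω₀) = −1` — which exists only for the norm class of `−η′` (F0P3-p01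
(g32) (L-RM0): the «translator class»).  The other classes of `T♮∕T_N` (the odd coset; the non-norm even coset) carry the whole anisotropic table and one row of the hyperbolic one
(this seat's class model, ★ `F0P3cDyRamToricCensusSumRamMParts` header: 5 524∕5 524 E1 cells).  THIS FILE counts them:
* §1 **`setOf_v_one_add_mul_twist_le_eq_smul_of_met`** — THE APPROXIMATE TRANSLATION LEMMA: if SOME unit `ω₁` meets the class at depth `r` (`|1 + η′t(ω₁)| ≤ r`), the depth set
  `{ω : |1 + η′t(ω)| ≤ r}` IS the translate `ω₁·B_r` of the norm-depth subgroup (`t` multiplicative, `(1 + η′t(ω₁ω′)) − (1 + η′t(ω₁)) = η′t(ω₁)(t(ω′) − 1)`, ultrametric both ways);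
  ★ p857299's lemma is the case `r`-independent exact translator.  `setOf_v_one_add_mul_twist_le_eq_empty`: no unit at depth `r` ⇒ the set is empty.
* §2 THE FIVE COUNTS in ★ p857385's letters with the translator hypothesis REPLACED: `a ≥ 1` — **`ncard_levelSetR_eq_relIndex_sub_of_le`** (a unit meets the class one step
  BELOW the level ⇒ `[B:H] − [B′:H]`), **`ncard_levelSetR_eq_relIndex_of_le_of_forall_not`** (met AT the level, not below ⇒ `[B:H]`: the last occupied level of a dying or
  constant class), **`ncard_levelSetR_eq_zero_of_forall_not`** (not met ⇒ `0`); `a = 0` — **`ncard_levelSetR_zero_eq_relIndex_of_le`** (`[B:H]`), **`ncard_levelSetR_zero_eq_zero_of_forall_not`** (`0`).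
* THE CLASS FACTS that decide WHERE a class is met are separate organs: the odd class has CONSTANT plus-depth `d′ − 1` (companion ★-filed
  `WildQuadraticDatumPlusDepth`: `v_add_map_eq_of_odd ∕ _of_even`, `v_skew_mul_add_map`), the non-norm even class is met at depth `c` iff `X_c ⊄ N` (★ p857360∕p857465's
  index-two dichotomy); their combination with §2 is the census head's.
HONEST LABEL: HC_CM is proved only modulo the 7 printed citations (2 remaining named inputs: hLiu418 = stmt-HodgeConjecture-24832, h413 = stmt-HodgeConjecture-24833) until rung 0
closes; unconditional local algebra, count-neutral (organ of the RamM census; no census value asserted, (ρ2b′-X) stays an OPEN prover target).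

## References
* [Flicker1998UnitaryFL] Y. Z. Flicker, *Elementary proof of the fundamental lemma for a unitary group*, Canad. J. Math. 50 (1998): p. 84 REMARK (Mars' orders and lattices `z·R_E(j)`).
* [Serre1979] J.-P. Serre, *Local Fields*, GTM 67 (1979): Ch. I §6 Prop. 18 (`𝒪_E = 𝒪_F[π]`), Ch. III §6 Prop. 13 (`𝒟 = (f′(π))`, the parity of its terms), Ch. V §1, §3.
* [Jacobowitz1962] R. Jacobowitz, *Hermitian forms over local fields*, Amer. J. Math. 84 (1962): §4.
-/

set_option autoImplicit false

open WithZero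
open scoped Pointwise

namespace Literature.NumberTheory.LocalFields.QuadraticOrder

variable {K : Type*} [Field K] [Valued K ℤᵐ⁰] {ρ Θ : K →+* K} {α ϖE h : K} {dρ : ℕ}

/-! ## §1 The APPROXIMATE translation lemma: a class met at depth `r` is a translate of the norm-depth subgroup `B_r` -/

/-- The hermitian norm of a unit is a unit: `|ω·Θω| = 1`. [cite: Jacobowitz1962, §4] -/
theorem v_mul_theta_eq_one (hvΘ : ∀ x, Valued.v (Θ x) = Valued.v x) {ω : K} (hω : Valued.v ω = 1) : Valued.v (ω * Θ ω) = 1 := by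
  rw [map_mul, hvΘ, hω, mul_one]

/-- The norm twist of a unit is a unit: `|ρ(ωΘω) ∕ (ωΘω)| = 1`. [cite: Jacobowitz1962, §4] -/
theorem v_twist_eq_one (hvρ : ∀ x, Valued.v (ρ x) = Valued.v x) (hvΘ : ∀ x, Valued.v (Θ x) = Valued.v x) {ω : K} (hω : Valued.v ω = 1) :
    Valued.v (ρ (ω * Θ ω) / (ω * Θ ω)) = 1 := by
  rw [map_div₀, hvρ, v_mul_theta_eq_one hvΘ hω, div_one]

/-- **THE APPROXIMATE TRANSLATION LEMMA.**  If the class `η` (a unit multiplier) is met at depth `r` by SOME unit `ω₁` — `|1 + η·t(ω₁)| ≤ r`, `t(ω) = ρ(ωΘω)∕(ωΘω)` — then the whole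
depth set `{ω : |ω| = 1, |1 + η·t(ω)| ≤ r}` is the translate `ω₁·B_r` of the norm-depth subgroup `B_r = {ω : |ωΘω − ρ(ωΘω)| ≤ r}` (`t` is multiplicative and
`(1 + ηt(ω₁ω′)) − (1 + ηt(ω₁)) = ηt(ω₁)(t(ω′) − 1)`, `|t(ω′) − 1| = |N(ω′) − ρN(ω′)|`).  ★ p857299's `setOf_v_one_add_mul_twist_le_eq_smul` is the case of an EXACT translator
(`η·t(ω₀) = −1`); the classes WITHOUT exact translator (the odd coset, the non-norm even coset of the RamM census) are reached by this one (LH4-p08 (g5)'s ★ p857519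
`…ToricLevelCensusUnr.setOf_v_one_add_mul_twist_le_eq_smul_of_le` is the same statement in the Summits-side type-U namespace; this is its Literature-level home). [cite: Serre1979, Ch. V §1] [cite: Jacobowitz1962, §4] -/
theorem setOf_v_one_add_mul_twist_le_eq_smul_of_met (hvρ : ∀ x, Valued.v (ρ x) = Valued.v x) (hvΘ : ∀ x, Valued.v (Θ x) = Valued.v x)
    {η : K} (hη : Valued.v η = 1) {ω₁ : Kˣ} (hω₁ : Valued.v (ω₁ : K) = 1) (r : ℤᵐ⁰)
    (hle : Valued.v (1 + η * (ρ ((ω₁ : K) * Θ ω₁) / ((ω₁ : K) * Θ ω₁))) ≤ r) {B : Subgroup Kˣ}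
    (hB : ∀ ω : Kˣ, ω ∈ B ↔ Valued.v (ω : K) = 1 ∧ Valued.v ((ω : K) * Θ ω - ρ ((ω : K) * Θ ω)) ≤ r) :
    {ω : Kˣ | Valued.v (ω : K) = 1 ∧ Valued.v (1 + η * (ρ ((ω : K) * Θ ω) / ((ω : K) * Θ ω))) ≤ r} = ω₁ • (B : Set Kˣ) := by
  have hN0 : ∀ {ω : K}, Valued.v ω = 1 → ω * Θ ω ≠ 0 := fun hω h0 => by
    have := v_mul_theta_eq_one hvΘ hω; rw [h0, map_zero] at this; exact zero_ne_one this
  -- multiplicativity of the twist and the key difference identity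
  have key : ∀ b : Kˣ, Valued.v (b : K) = 1 →
      1 + η * (ρ (((ω₁ * b : Kˣ) : K) * Θ ((ω₁ * b : Kˣ) : K)) / (((ω₁ * b : Kˣ) : K) * Θ ((ω₁ * b : Kˣ) : K))) -
        (1 + η * (ρ ((ω₁ : K) * Θ ω₁) / ((ω₁ : K) * Θ ω₁))) =
      η * (ρ ((ω₁ : K) * Θ ω₁) / ((ω₁ : K) * Θ ω₁)) * (ρ ((b : K) * Θ b) / ((b : K) * Θ b) - 1) := by
    intro b hb
    have h1 : ((ω₁ : K) * Θ ω₁) ≠ 0 := hN0 hω₁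
    have h2 : ((b : K) * Θ b) ≠ 0 := hN0 hb
    rw [Units.val_mul, show ((ω₁ : K) * b) * Θ ((ω₁ : K) * b) = ((ω₁ : K) * Θ ω₁) * ((b : K) * Θ b) by rw [map_mul]; ring, map_mul,
      mul_div_mul_comm]
    ring
  have hvd : ∀ b : Kˣ, Valued.v (b : K) = 1 →
      Valued.v (1 + η * (ρ (((ω₁ * b : Kˣ) : K) * Θ ((ω₁ * b : Kˣ) : K)) / (((ω₁ * b : Kˣ) : K) * Θ ((ω₁ * b : Kˣ) : K))) -
        (1 + η * (ρ ((ω₁ : K) * Θ ω₁) / ((ω₁ : K) * Θ ω₁)))) = Valued.v ((b : K) * Θ b - ρ ((b : K) * Θ b)) := by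
    intro b hb
    rw [key b hb, map_mul, map_mul, hη, v_twist_eq_one hvρ hvΘ hω₁, one_mul, one_mul, v_twist_sub_one (v_mul_theta_eq_one hvΘ hb)]
  ext ω
  rw [Set.mem_setOf_eq, Set.mem_smul_set]
  constructor
  · rintro ⟨hω, hωle⟩
    refine ⟨ω₁⁻¹ * ω, (hB _).2 ⟨?_, ?_⟩, by rw [smul_eq_mul, mul_inv_cancel_left]⟩
    · rw [Units.val_mul, Units.val_inv_eq_inv_val, map_mul, map_inv₀, hω₁, hω, inv_one, one_mul]
    · have hb : Valued.v ((ω₁⁻¹ * ω : Kˣ) : K) = 1 := by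
        rw [Units.val_mul, Units.val_inv_eq_inv_val, map_mul, map_inv₀, hω₁, hω, inv_one, one_mul]
      have h := hvd (ω₁⁻¹ * ω) hb
      rw [mul_inv_cancel_left] at h
      rw [← h]
      exact (Valuation.map_sub _ _ _).trans (max_le hωle hle)
  · rintro ⟨b, hbB, rfl⟩
    obtain ⟨hb, hbr⟩ := (hB b).1 hbB
    refine ⟨by rw [smul_eq_mul, Units.val_mul, map_mul, hω₁, hb, one_mul], ?_⟩
    rw [smul_eq_mul]
    have h := hvd b hb
    have e : 1 + η * (ρ (((ω₁ * b : Kˣ) : K) * Θ ((ω₁ * b : Kˣ) : K)) / (((ω₁ * b : Kˣ) : K) * Θ ((ω₁ * b : Kˣ) : K))) =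
        (1 + η * (ρ (((ω₁ * b : Kˣ) : K) * Θ ((ω₁ * b : Kˣ) : K)) / (((ω₁ * b : Kˣ) : K) * Θ ((ω₁ * b : Kˣ) : K))) -
          (1 + η * (ρ ((ω₁ : K) * Θ ω₁) / ((ω₁ : K) * Θ ω₁)))) + (1 + η * (ρ ((ω₁ : K) * Θ ω₁) / ((ω₁ : K) * Θ ω₁))) := by ring
    rw [e]
    exact (Valuation.map_add _ _ _).trans (max_le (by rw [h]; exact hbr) hle)

/-- **NO APPROXIMATE TRANSLATOR ⇒ THE DEPTH SET IS EMPTY** (definitional bookkeeping on the filtration sets). [cite: Serre1979, Ch. V §1] -/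
theorem setOf_v_one_add_mul_twist_le_eq_empty {η : K} (r : ℤᵐ⁰)
    (hnone : ∀ ω : Kˣ, Valued.v (ω : K) = 1 → ¬ Valued.v (1 + η * (ρ ((ω : K) * Θ ω) / ((ω : K) * Θ ω))) ≤ r) :
    {ω : Kˣ | Valued.v (ω : K) = 1 ∧ Valued.v (1 + η * (ρ ((ω : K) * Θ ω) / ((ω : K) * Θ ω))) ≤ r} = ∅ := by
  ext ω
  simp only [Set.mem_setOf_eq, Set.mem_empty_iff_false, iff_false, not_and]
  exact hnone ω


/-! ## §2 THE COUNTS OF THE RamM LEVEL SETS WITH AN APPROXIMATE TRANSLATOR (or none) — ★ p857385's three theorems without the exact-translator hypothesis `η′·t(ω₀) = −1`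
(`η′ = η·t(α^{k₀})`, `η = ρh∕h`).  For the classes WITHOUT exact translator (odd coset; non-norm even coset) these are the counting sentences; the class facts deciding at which
depths an approximate translator exists are the companion `WildQuadraticDatumPlusDepth` (odd coset: constant plus-depth `d′ − 1`) and ★ p857465's index-two dichotomy (non-norm even
coset: exactly below the conductor). -/

/-- The class multiplier `η′ = (ρh∕h)·t(α^{k₀})` is a unit (`ρ`, `Θ` isometric). [cite: Jacobowitz1962, §4] -/
theorem v_classMult_eq_one (hvρ : ∀ x, Valued.v (ρ x) = Valued.v x) (hvΘ : ∀ x, Valued.v (Θ x) = Valued.v x) (hh : h ≠ 0) (hα0 : α ≠ 0) (k₀ : ℤ) :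
    Valued.v (ρ h / h * (ρ (α ^ k₀ * Θ (α ^ k₀)) / (α ^ k₀ * Θ (α ^ k₀)))) = 1 := by
  have hh' : Valued.v h ≠ 0 := (Valuation.ne_zero_iff _).2 hh
  have hN : Valued.v (α ^ k₀ * Θ (α ^ k₀)) ≠ 0 := by
    rw [map_mul, hvΘ]; exact mul_ne_zero ((Valuation.ne_zero_iff _).2 (zpow_ne_zero _ hα0)) ((Valuation.ne_zero_iff _).2 (zpow_ne_zero _ hα0))
  rw [map_mul, map_div₀, map_div₀, hvρ, hvρ, div_self hh', div_self hN, one_mul]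

/-- **THE COUNT, `a ≥ 1`, DEEP APPROXIMATE TRANSLATOR**: if some unit `ω₁` meets the class one step BELOW the level (`|1 + η′t(ω₁)| ≤ exp(2a − 2j − d_ρ − 1)`), the level-`a` order
lattices number `[B : H] − [B′ : H]` exactly as in the exact-translator case (★ `ncard_levelSetR_eq_relIndex_sub`). [cite: Flicker1998UnitaryFL, p. 84] [cite: Serre1979, Ch. V §3] -/
theorem ncard_levelSetR_eq_relIndex_sub_of_le (hρρ : ∀ x, ρ (ρ x) = x) (hvρ : ∀ x, Valued.v (ρ x) = Valued.v x) (hvΘ : ∀ x, Valued.v (Θ x) = Valued.v x)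
    (hfix : ∀ c : K, ρ c = c → c ≠ 0 → ∃ n : ℤ, Valued.v c = exp (2 * n)) (hρα : ρ α ≠ α)
    (hα : Valued.v α = exp (-1 : ℤ)) (hdρ : Valued.v (α - ρ α) = exp (-(dρ : ℤ))) (hϖE : Valued.v ϖE = exp (-2 : ℤ)) (hρϖ : ρ ϖE = ϖE)
    (hh : h ≠ 0) {vh : ℤ} (hvh : Valued.v h = exp (-vh)) (j : ℕ) {a : ℕ} (ha : 1 ≤ a) {k₀ : ℤ} (hk₀ : vh + dρ + 2 * k₀ + 2 * j = 2 * a)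
    {ω₁ : Kˣ} (hω₁ : Valued.v (ω₁ : K) = 1) (hle : Valued.v (1 + (ρ h / h * (ρ (α ^ k₀ * Θ (α ^ k₀)) / (α ^ k₀ * Θ (α ^ k₀)))) * (ρ ((ω₁ : K) * Θ ω₁) / ((ω₁ : K) * Θ ω₁))) ≤ exp (2 * (a : ℤ) - 2 * j - dρ - 1))
    (H B B' : Subgroup Kˣ) (hH : ∀ u : Kˣ, u ∈ H ↔ Valued.v (u : K) = 1 ∧ Valued.v ((u : K) - ρ u) ≤ Valued.v (ϖE ^ j * (α - ρ α)))
    (hB : ∀ ω : Kˣ, ω ∈ B ↔ Valued.v (ω : K) = 1 ∧ Valued.v ((ω : K) * Θ ω - ρ ((ω : K) * Θ ω)) ≤ exp (2 * (a : ℤ) - 2 * j - dρ))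
    (hB' : ∀ ω : Kˣ, ω ∈ B' ↔ Valued.v (ω : K) = 1 ∧ Valued.v ((ω : K) * Θ ω - ρ ((ω : K) * Θ ω)) ≤ exp (2 * (a : ℤ) - 2 * j - dρ - 1))
    (hHB' : H ≤ B') (hfin : ((QuotientGroup.mk : Kˣ → Kˣ ⧸ H) '' (ω₁ • (B : Set Kˣ))).Finite) :
    {Λ : AddSubgroup K | ∃ x₀ : K, x₀ ≠ 0 ∧ (∀ x, x ∈ Λ ↔ ∃ z, (Valued.v z ≤ 1 ∧ Valued.v (z - ρ z) ≤ Valued.v (ϖE ^ j * (α - ρ α))) ∧ x = x₀ * z) ∧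
        (Valued.v (h * (x₀ * Θ x₀) * (ϖE ^ j * (α - ρ α))) ≤ 1 ∧
            Valued.v (h * (x₀ * Θ x₀) * (ϖE ^ j * (α - ρ α)) - ρ (h * (x₀ * Θ x₀) * (ϖE ^ j * (α - ρ α)))) ≤ Valued.v (ϖE ^ j * (α - ρ α))) ∧
          ¬ (Valued.v (h * (x₀ * Θ x₀) * (ϖE ^ j * (α - ρ α)) / ϖE) ≤ 1 ∧
              Valued.v (h * (x₀ * Θ x₀) * (ϖE ^ j * (α - ρ α)) / ϖE - ρ (h * (x₀ * Θ x₀) * (ϖE ^ j * (α - ρ α)) / ϖE)) ≤ Valued.v (ϖE ^ j * (α - ρ α))) ∧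
            Valued.v (h * (x₀ * Θ x₀) * (ϖE ^ j * (α - ρ α))) = Valued.v ϖE ^ a}.ncard = H.relIndex B - H.relIndex B' := by
  obtain ⟨hα0, -⟩ := ne_zero_and_v_zpow_of_v_eq hα 0
  have hη1 := v_classMult_eq_one (Θ := Θ) hvρ hvΘ hh hα0 k₀
  have hleB : Valued.v (1 + (ρ h / h * (ρ (α ^ k₀ * Θ (α ^ k₀)) / (α ^ k₀ * Θ (α ^ k₀)))) * (ρ ((ω₁ : K) * Θ ω₁) / ((ω₁ : K) * Θ ω₁))) ≤ exp (2 * (a : ℤ) - 2 * j - dρ) := hle.trans (by rw [exp_le_exp]; omega)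
  have hA := ncard_setOf_orderLattice_eq_ncard_image_mk hvρ hH (fun x₀ : Kˣ =>
    ((Valued.v (h * ((x₀ : K) * Θ x₀) * (ϖE ^ j * (α - ρ α))) ≤ 1 ∧
          Valued.v (h * ((x₀ : K) * Θ x₀) * (ϖE ^ j * (α - ρ α)) - ρ (h * ((x₀ : K) * Θ x₀) * (ϖE ^ j * (α - ρ α)))) ≤ Valued.v (ϖE ^ j * (α - ρ α))) ∧
        ¬ (Valued.v (h * ((x₀ : K) * Θ x₀) * (ϖE ^ j * (α - ρ α)) / ϖE) ≤ 1 ∧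
            Valued.v (h * ((x₀ : K) * Θ x₀) * (ϖE ^ j * (α - ρ α)) / ϖE - ρ (h * ((x₀ : K) * Θ x₀) * (ϖE ^ j * (α - ρ α)) / ϖE)) ≤ Valued.v (ϖE ^ j * (α - ρ α)))) ∧
      Valued.v (h * ((x₀ : K) * Θ x₀) * (ϖE ^ j * (α - ρ α))) = Valued.v ϖE ^ a)
  have hsets : {Λ : AddSubgroup K | ∃ x₀ : K, x₀ ≠ 0 ∧ (∀ x, x ∈ Λ ↔ ∃ z, (Valued.v z ≤ 1 ∧ Valued.v (z - ρ z) ≤ Valued.v (ϖE ^ j * (α - ρ α))) ∧ x = x₀ * z) ∧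
        (Valued.v (h * (x₀ * Θ x₀) * (ϖE ^ j * (α - ρ α))) ≤ 1 ∧
            Valued.v (h * (x₀ * Θ x₀) * (ϖE ^ j * (α - ρ α)) - ρ (h * (x₀ * Θ x₀) * (ϖE ^ j * (α - ρ α)))) ≤ Valued.v (ϖE ^ j * (α - ρ α))) ∧
          ¬ (Valued.v (h * (x₀ * Θ x₀) * (ϖE ^ j * (α - ρ α)) / ϖE) ≤ 1 ∧
              Valued.v (h * (x₀ * Θ x₀) * (ϖE ^ j * (α - ρ α)) / ϖE - ρ (h * (x₀ * Θ x₀) * (ϖE ^ j * (α - ρ α)) / ϖE)) ≤ Valued.v (ϖE ^ j * (α - ρ α))) ∧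
            Valued.v (h * (x₀ * Θ x₀) * (ϖE ^ j * (α - ρ α))) = Valued.v ϖE ^ a} =
      {Λ : AddSubgroup K | ∃ x₀ : Kˣ,
        (((Valued.v (h * ((x₀ : K) * Θ x₀) * (ϖE ^ j * (α - ρ α))) ≤ 1 ∧
          Valued.v (h * ((x₀ : K) * Θ x₀) * (ϖE ^ j * (α - ρ α)) - ρ (h * ((x₀ : K) * Θ x₀) * (ϖE ^ j * (α - ρ α)))) ≤ Valued.v (ϖE ^ j * (α - ρ α))) ∧
        ¬ (Valued.v (h * ((x₀ : K) * Θ x₀) * (ϖE ^ j * (α - ρ α)) / ϖE) ≤ 1 ∧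
            Valued.v (h * ((x₀ : K) * Θ x₀) * (ϖE ^ j * (α - ρ α)) / ϖE - ρ (h * ((x₀ : K) * Θ x₀) * (ϖE ^ j * (α - ρ α)) / ϖE)) ≤ Valued.v (ϖE ^ j * (α - ρ α)))) ∧
      Valued.v (h * ((x₀ : K) * Θ x₀) * (ϖE ^ j * (α - ρ α))) = Valued.v ϖE ^ a) ∧
        ∀ x, x ∈ Λ ↔ ∃ y, (Valued.v y ≤ 1 ∧ Valued.v (y - ρ y) ≤ Valued.v (ϖE ^ j * (α - ρ α))) ∧ x = (x₀ : K) * y} := by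
    ext Λ
    simp only [Set.mem_setOf_eq]
    constructor
    · rintro ⟨x₀, hx₀, hmem, hP1, hP2, hL⟩; exact ⟨Units.mk0 x₀ hx₀, ⟨⟨hP1, hP2⟩, hL⟩, hmem⟩
    · rintro ⟨x₀, ⟨⟨hP1, hP2⟩, hL⟩, hmem⟩; exact ⟨(x₀ : K), x₀.ne_zero, hmem, hP1, hP2, hL⟩
  rw [hsets, hA, setOf_levelGenR_eq_smul_of_pos hρρ hvΘ hfix hρα hα hdρ hϖE hρϖ hα0 hh hvh j ha hk₀, ncard_image_mk_smul, setOf_twistDepth_eq_diff,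
    setOf_v_one_add_mul_twist_le_eq_smul_of_met hvρ hvΘ hη1 hω₁ _ hleB hB, setOf_v_one_add_mul_twist_le_eq_smul_of_met hvρ hvΘ hη1 hω₁ _ hle hB']
  rw [ncard_image_mk_diff H ?_ ?_ hfin, ncard_image_mk_smul_subgroup, ncard_image_mk_smul_subgroup]
  · refine Set.smul_set_mono ?_
    intro ω hω
    obtain ⟨h1, h2⟩ := (hB' ω).1 hω
    exact (hB ω).2 ⟨h1, h2.trans (by rw [exp_le_exp]; omega)⟩
  · intro x hx u hu
    obtain ⟨b, hb, rfl⟩ := Set.mem_smul_set.1 hx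
    refine Set.mem_smul_set.2 ⟨u * b, B'.mul_mem (hHB' hu) hb, ?_⟩
    simp only [smul_eq_mul]; rw [mul_left_comm]

/-- **THE COUNT, `a ≥ 1`, APPROXIMATE TRANSLATOR AT THE LEVEL BUT NONE BELOW**: if a unit `ω₁` meets the class at depth `exp(2a − 2j − d_ρ)` and NO unit meets it one step deeper,
the whole depth set is the level set: the lattices number `[B : H]` (the last occupied level of a constant or dying class). [cite: Flicker1998UnitaryFL, p. 84] [cite: Serre1979, Ch. V §3] -/
theorem ncard_levelSetR_eq_relIndex_of_le_of_forall_not (hρρ : ∀ x, ρ (ρ x) = x) (hvρ : ∀ x, Valued.v (ρ x) = Valued.v x) (hvΘ : ∀ x, Valued.v (Θ x) = Valued.v x)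
    (hfix : ∀ c : K, ρ c = c → c ≠ 0 → ∃ n : ℤ, Valued.v c = exp (2 * n)) (hρα : ρ α ≠ α)
    (hα : Valued.v α = exp (-1 : ℤ)) (hdρ : Valued.v (α - ρ α) = exp (-(dρ : ℤ))) (hϖE : Valued.v ϖE = exp (-2 : ℤ)) (hρϖ : ρ ϖE = ϖE)
    (hh : h ≠ 0) {vh : ℤ} (hvh : Valued.v h = exp (-vh)) (j : ℕ) {a : ℕ} (ha : 1 ≤ a) {k₀ : ℤ} (hk₀ : vh + dρ + 2 * k₀ + 2 * j = 2 * a)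
    {ω₁ : Kˣ} (hω₁ : Valued.v (ω₁ : K) = 1) (hle : Valued.v (1 + (ρ h / h * (ρ (α ^ k₀ * Θ (α ^ k₀)) / (α ^ k₀ * Θ (α ^ k₀)))) * (ρ ((ω₁ : K) * Θ ω₁) / ((ω₁ : K) * Θ ω₁))) ≤ exp (2 * (a : ℤ) - 2 * j - dρ))
    (hnone : ∀ ω : Kˣ, Valued.v (ω : K) = 1 → ¬ Valued.v (1 + (ρ h / h * (ρ (α ^ k₀ * Θ (α ^ k₀)) / (α ^ k₀ * Θ (α ^ k₀)))) * (ρ ((ω : K) * Θ ω) / ((ω : K) * Θ ω))) ≤ exp (2 * (a : ℤ) - 2 * j - dρ - 1))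
    (H B : Subgroup Kˣ) (hH : ∀ u : Kˣ, u ∈ H ↔ Valued.v (u : K) = 1 ∧ Valued.v ((u : K) - ρ u) ≤ Valued.v (ϖE ^ j * (α - ρ α)))
    (hB : ∀ ω : Kˣ, ω ∈ B ↔ Valued.v (ω : K) = 1 ∧ Valued.v ((ω : K) * Θ ω - ρ ((ω : K) * Θ ω)) ≤ exp (2 * (a : ℤ) - 2 * j - dρ)) :
    {Λ : AddSubgroup K | ∃ x₀ : K, x₀ ≠ 0 ∧ (∀ x, x ∈ Λ ↔ ∃ z, (Valued.v z ≤ 1 ∧ Valued.v (z - ρ z) ≤ Valued.v (ϖE ^ j * (α - ρ α))) ∧ x = x₀ * z) ∧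
        (Valued.v (h * (x₀ * Θ x₀) * (ϖE ^ j * (α - ρ α))) ≤ 1 ∧
            Valued.v (h * (x₀ * Θ x₀) * (ϖE ^ j * (α - ρ α)) - ρ (h * (x₀ * Θ x₀) * (ϖE ^ j * (α - ρ α)))) ≤ Valued.v (ϖE ^ j * (α - ρ α))) ∧
          ¬ (Valued.v (h * (x₀ * Θ x₀) * (ϖE ^ j * (α - ρ α)) / ϖE) ≤ 1 ∧
              Valued.v (h * (x₀ * Θ x₀) * (ϖE ^ j * (α - ρ α)) / ϖE - ρ (h * (x₀ * Θ x₀) * (ϖE ^ j * (α - ρ α)) / ϖE)) ≤ Valued.v (ϖE ^ j * (α - ρ α))) ∧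
            Valued.v (h * (x₀ * Θ x₀) * (ϖE ^ j * (α - ρ α))) = Valued.v ϖE ^ a}.ncard = H.relIndex B := by
  obtain ⟨hα0, -⟩ := ne_zero_and_v_zpow_of_v_eq hα 0
  have hη1 := v_classMult_eq_one (Θ := Θ) hvρ hvΘ hh hα0 k₀
  have hA := ncard_setOf_orderLattice_eq_ncard_image_mk hvρ hH (fun x₀ : Kˣ =>
    ((Valued.v (h * ((x₀ : K) * Θ x₀) * (ϖE ^ j * (α - ρ α))) ≤ 1 ∧
          Valued.v (h * ((x₀ : K) * Θ x₀) * (ϖE ^ j * (α - ρ α)) - ρ (h * ((x₀ : K) * Θ x₀) * (ϖE ^ j * (α - ρ α)))) ≤ Valued.v (ϖE ^ j * (α - ρ α))) ∧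
        ¬ (Valued.v (h * ((x₀ : K) * Θ x₀) * (ϖE ^ j * (α - ρ α)) / ϖE) ≤ 1 ∧
            Valued.v (h * ((x₀ : K) * Θ x₀) * (ϖE ^ j * (α - ρ α)) / ϖE - ρ (h * ((x₀ : K) * Θ x₀) * (ϖE ^ j * (α - ρ α)) / ϖE)) ≤ Valued.v (ϖE ^ j * (α - ρ α)))) ∧
      Valued.v (h * ((x₀ : K) * Θ x₀) * (ϖE ^ j * (α - ρ α))) = Valued.v ϖE ^ a)
  have hsets : {Λ : AddSubgroup K | ∃ x₀ : K, x₀ ≠ 0 ∧ (∀ x, x ∈ Λ ↔ ∃ z, (Valued.v z ≤ 1 ∧ Valued.v (z - ρ z) ≤ Valued.v (ϖE ^ j * (α - ρ α))) ∧ x = x₀ * z) ∧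
        (Valued.v (h * (x₀ * Θ x₀) * (ϖE ^ j * (α - ρ α))) ≤ 1 ∧
            Valued.v (h * (x₀ * Θ x₀) * (ϖE ^ j * (α - ρ α)) - ρ (h * (x₀ * Θ x₀) * (ϖE ^ j * (α - ρ α)))) ≤ Valued.v (ϖE ^ j * (α - ρ α))) ∧
          ¬ (Valued.v (h * (x₀ * Θ x₀) * (ϖE ^ j * (α - ρ α)) / ϖE) ≤ 1 ∧
              Valued.v (h * (x₀ * Θ x₀) * (ϖE ^ j * (α - ρ α)) / ϖE - ρ (h * (x₀ * Θ x₀) * (ϖE ^ j * (α - ρ α)) / ϖE)) ≤ Valued.v (ϖE ^ j * (α - ρ α))) ∧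
            Valued.v (h * (x₀ * Θ x₀) * (ϖE ^ j * (α - ρ α))) = Valued.v ϖE ^ a} =
      {Λ : AddSubgroup K | ∃ x₀ : Kˣ,
        (((Valued.v (h * ((x₀ : K) * Θ x₀) * (ϖE ^ j * (α - ρ α))) ≤ 1 ∧
          Valued.v (h * ((x₀ : K) * Θ x₀) * (ϖE ^ j * (α - ρ α)) - ρ (h * ((x₀ : K) * Θ x₀) * (ϖE ^ j * (α - ρ α)))) ≤ Valued.v (ϖE ^ j * (α - ρ α))) ∧
        ¬ (Valued.v (h * ((x₀ : K) * Θ x₀) * (ϖE ^ j * (α - ρ α)) / ϖE) ≤ 1 ∧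
            Valued.v (h * ((x₀ : K) * Θ x₀) * (ϖE ^ j * (α - ρ α)) / ϖE - ρ (h * ((x₀ : K) * Θ x₀) * (ϖE ^ j * (α - ρ α)) / ϖE)) ≤ Valued.v (ϖE ^ j * (α - ρ α)))) ∧
      Valued.v (h * ((x₀ : K) * Θ x₀) * (ϖE ^ j * (α - ρ α))) = Valued.v ϖE ^ a) ∧
        ∀ x, x ∈ Λ ↔ ∃ y, (Valued.v y ≤ 1 ∧ Valued.v (y - ρ y) ≤ Valued.v (ϖE ^ j * (α - ρ α))) ∧ x = (x₀ : K) * y} := by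
    ext Λ
    simp only [Set.mem_setOf_eq]
    constructor
    · rintro ⟨x₀, hx₀, hmem, hP1, hP2, hL⟩; exact ⟨Units.mk0 x₀ hx₀, ⟨⟨hP1, hP2⟩, hL⟩, hmem⟩
    · rintro ⟨x₀, ⟨⟨hP1, hP2⟩, hL⟩, hmem⟩; exact ⟨(x₀ : K), x₀.ne_zero, hmem, hP1, hP2, hL⟩
  rw [hsets, hA, setOf_levelGenR_eq_smul_of_pos hρρ hvΘ hfix hρα hα hdρ hϖE hρϖ hα0 hh hvh j ha hk₀, ncard_image_mk_smul, setOf_twistDepth_eq_diff,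
    setOf_v_one_add_mul_twist_le_eq_smul_of_met hvρ hvΘ hη1 hω₁ _ hle hB, setOf_v_one_add_mul_twist_le_eq_empty _ hnone, Set.sdiff_empty,
    ncard_image_mk_smul_subgroup]

/-- **THE COUNT, `a ≥ 1`, CLASS NOT MET AT THE LEVEL**: if NO unit meets the class at depth `exp(2a − 2j − d_ρ)`, the level is EMPTY (count `0`). [cite: Flicker1998UnitaryFL, p. 84] -/
theorem ncard_levelSetR_eq_zero_of_forall_not (hρρ : ∀ x, ρ (ρ x) = x) (hvρ : ∀ x, Valued.v (ρ x) = Valued.v x) (hvΘ : ∀ x, Valued.v (Θ x) = Valued.v x)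
    (hfix : ∀ c : K, ρ c = c → c ≠ 0 → ∃ n : ℤ, Valued.v c = exp (2 * n)) (hρα : ρ α ≠ α)
    (hα : Valued.v α = exp (-1 : ℤ)) (hdρ : Valued.v (α - ρ α) = exp (-(dρ : ℤ))) (hϖE : Valued.v ϖE = exp (-2 : ℤ)) (hρϖ : ρ ϖE = ϖE)
    (hh : h ≠ 0) {vh : ℤ} (hvh : Valued.v h = exp (-vh)) (j : ℕ) {a : ℕ} (ha : 1 ≤ a) {k₀ : ℤ} (hk₀ : vh + dρ + 2 * k₀ + 2 * j = 2 * a)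
    (hnone : ∀ ω : Kˣ, Valued.v (ω : K) = 1 → ¬ Valued.v (1 + (ρ h / h * (ρ (α ^ k₀ * Θ (α ^ k₀)) / (α ^ k₀ * Θ (α ^ k₀)))) * (ρ ((ω : K) * Θ ω) / ((ω : K) * Θ ω))) ≤ exp (2 * (a : ℤ) - 2 * j - dρ))
    (H : Subgroup Kˣ) (hH : ∀ u : Kˣ, u ∈ H ↔ Valued.v (u : K) = 1 ∧ Valued.v ((u : K) - ρ u) ≤ Valued.v (ϖE ^ j * (α - ρ α))) :
    {Λ : AddSubgroup K | ∃ x₀ : K, x₀ ≠ 0 ∧ (∀ x, x ∈ Λ ↔ ∃ z, (Valued.v z ≤ 1 ∧ Valued.v (z - ρ z) ≤ Valued.v (ϖE ^ j * (α - ρ α))) ∧ x = x₀ * z) ∧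
        (Valued.v (h * (x₀ * Θ x₀) * (ϖE ^ j * (α - ρ α))) ≤ 1 ∧
            Valued.v (h * (x₀ * Θ x₀) * (ϖE ^ j * (α - ρ α)) - ρ (h * (x₀ * Θ x₀) * (ϖE ^ j * (α - ρ α)))) ≤ Valued.v (ϖE ^ j * (α - ρ α))) ∧
          ¬ (Valued.v (h * (x₀ * Θ x₀) * (ϖE ^ j * (α - ρ α)) / ϖE) ≤ 1 ∧
              Valued.v (h * (x₀ * Θ x₀) * (ϖE ^ j * (α - ρ α)) / ϖE - ρ (h * (x₀ * Θ x₀) * (ϖE ^ j * (α - ρ α)) / ϖE)) ≤ Valued.v (ϖE ^ j * (α - ρ α))) ∧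
            Valued.v (h * (x₀ * Θ x₀) * (ϖE ^ j * (α - ρ α))) = Valued.v ϖE ^ a}.ncard = 0 := by
  obtain ⟨hα0, -⟩ := ne_zero_and_v_zpow_of_v_eq hα 0
  have hA := ncard_setOf_orderLattice_eq_ncard_image_mk hvρ hH (fun x₀ : Kˣ =>
    ((Valued.v (h * ((x₀ : K) * Θ x₀) * (ϖE ^ j * (α - ρ α))) ≤ 1 ∧
          Valued.v (h * ((x₀ : K) * Θ x₀) * (ϖE ^ j * (α - ρ α)) - ρ (h * ((x₀ : K) * Θ x₀) * (ϖE ^ j * (α - ρ α)))) ≤ Valued.v (ϖE ^ j * (α - ρ α))) ∧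
        ¬ (Valued.v (h * ((x₀ : K) * Θ x₀) * (ϖE ^ j * (α - ρ α)) / ϖE) ≤ 1 ∧
            Valued.v (h * ((x₀ : K) * Θ x₀) * (ϖE ^ j * (α - ρ α)) / ϖE - ρ (h * ((x₀ : K) * Θ x₀) * (ϖE ^ j * (α - ρ α)) / ϖE)) ≤ Valued.v (ϖE ^ j * (α - ρ α)))) ∧
      Valued.v (h * ((x₀ : K) * Θ x₀) * (ϖE ^ j * (α - ρ α))) = Valued.v ϖE ^ a)
  have hsets : {Λ : AddSubgroup K | ∃ x₀ : K, x₀ ≠ 0 ∧ (∀ x, x ∈ Λ ↔ ∃ z, (Valued.v z ≤ 1 ∧ Valued.v (z - ρ z) ≤ Valued.v (ϖE ^ j * (α - ρ α))) ∧ x = x₀ * z) ∧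
        (Valued.v (h * (x₀ * Θ x₀) * (ϖE ^ j * (α - ρ α))) ≤ 1 ∧
            Valued.v (h * (x₀ * Θ x₀) * (ϖE ^ j * (α - ρ α)) - ρ (h * (x₀ * Θ x₀) * (ϖE ^ j * (α - ρ α)))) ≤ Valued.v (ϖE ^ j * (α - ρ α))) ∧
          ¬ (Valued.v (h * (x₀ * Θ x₀) * (ϖE ^ j * (α - ρ α)) / ϖE) ≤ 1 ∧
              Valued.v (h * (x₀ * Θ x₀) * (ϖE ^ j * (α - ρ α)) / ϖE - ρ (h * (x₀ * Θ x₀) * (ϖE ^ j * (α - ρ α)) / ϖE)) ≤ Valued.v (ϖE ^ j * (α - ρ α))) ∧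
            Valued.v (h * (x₀ * Θ x₀) * (ϖE ^ j * (α - ρ α))) = Valued.v ϖE ^ a} =
      {Λ : AddSubgroup K | ∃ x₀ : Kˣ,
        (((Valued.v (h * ((x₀ : K) * Θ x₀) * (ϖE ^ j * (α - ρ α))) ≤ 1 ∧
          Valued.v (h * ((x₀ : K) * Θ x₀) * (ϖE ^ j * (α - ρ α)) - ρ (h * ((x₀ : K) * Θ x₀) * (ϖE ^ j * (α - ρ α)))) ≤ Valued.v (ϖE ^ j * (α - ρ α))) ∧
        ¬ (Valued.v (h * ((x₀ : K) * Θ x₀) * (ϖE ^ j * (α - ρ α)) / ϖE) ≤ 1 ∧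
            Valued.v (h * ((x₀ : K) * Θ x₀) * (ϖE ^ j * (α - ρ α)) / ϖE - ρ (h * ((x₀ : K) * Θ x₀) * (ϖE ^ j * (α - ρ α)) / ϖE)) ≤ Valued.v (ϖE ^ j * (α - ρ α)))) ∧
      Valued.v (h * ((x₀ : K) * Θ x₀) * (ϖE ^ j * (α - ρ α))) = Valued.v ϖE ^ a) ∧
        ∀ x, x ∈ Λ ↔ ∃ y, (Valued.v y ≤ 1 ∧ Valued.v (y - ρ y) ≤ Valued.v (ϖE ^ j * (α - ρ α))) ∧ x = (x₀ : K) * y} := by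
    ext Λ
    simp only [Set.mem_setOf_eq]
    constructor
    · rintro ⟨x₀, hx₀, hmem, hP1, hP2, hL⟩; exact ⟨Units.mk0 x₀ hx₀, ⟨⟨hP1, hP2⟩, hL⟩, hmem⟩
    · rintro ⟨x₀, ⟨⟨hP1, hP2⟩, hL⟩, hmem⟩; exact ⟨(x₀ : K), x₀.ne_zero, hmem, hP1, hP2, hL⟩
  rw [hsets, hA, setOf_levelGenR_eq_smul_of_pos hρρ hvΘ hfix hρα hα hdρ hϖE hρϖ hα0 hh hvh j ha hk₀, ncard_image_mk_smul, setOf_twistDepth_eq_diff,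
    setOf_v_one_add_mul_twist_le_eq_empty _ hnone, Set.empty_sdiff, Set.image_empty, Set.ncard_empty]

/-- **THE COUNT, `a = 0`, APPROXIMATE TRANSLATOR**: with `v_h + d_ρ + 2k₀ + 2j = 0` and a unit meeting the class at depth `exp(−(2j + d_ρ))`, the level-`0` lattices number `[B : H]`.
[cite: Flicker1998UnitaryFL, p. 84] -/
theorem ncard_levelSetR_zero_eq_relIndex_of_le (hρρ : ∀ x, ρ (ρ x) = x) (hvρ : ∀ x, Valued.v (ρ x) = Valued.v x) (hvΘ : ∀ x, Valued.v (Θ x) = Valued.v x)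
    (hfix : ∀ c : K, ρ c = c → c ≠ 0 → ∃ n : ℤ, Valued.v c = exp (2 * n)) (hρα : ρ α ≠ α)
    (hα : Valued.v α = exp (-1 : ℤ)) (hdρ : Valued.v (α - ρ α) = exp (-(dρ : ℤ))) (hϖE : Valued.v ϖE = exp (-2 : ℤ)) (hρϖ : ρ ϖE = ϖE)
    (hh : h ≠ 0) {vh : ℤ} (hvh : Valued.v h = exp (-vh)) (j : ℕ) {k₀ : ℤ} (hk₀ : vh + dρ + 2 * k₀ + 2 * j = 0)
    {ω₁ : Kˣ} (hω₁ : Valued.v (ω₁ : K) = 1) (hle : Valued.v (1 + (ρ h / h * (ρ (α ^ k₀ * Θ (α ^ k₀)) / (α ^ k₀ * Θ (α ^ k₀)))) * (ρ ((ω₁ : K) * Θ ω₁) / ((ω₁ : K) * Θ ω₁))) ≤ exp (-(2 * (j : ℤ) + dρ)))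
    (H B : Subgroup Kˣ) (hH : ∀ u : Kˣ, u ∈ H ↔ Valued.v (u : K) = 1 ∧ Valued.v ((u : K) - ρ u) ≤ Valued.v (ϖE ^ j * (α - ρ α)))
    (hB : ∀ ω : Kˣ, ω ∈ B ↔ Valued.v (ω : K) = 1 ∧ Valued.v ((ω : K) * Θ ω - ρ ((ω : K) * Θ ω)) ≤ exp (-(2 * (j : ℤ) + dρ))) :
    {Λ : AddSubgroup K | ∃ x₀ : K, x₀ ≠ 0 ∧ (∀ x, x ∈ Λ ↔ ∃ z, (Valued.v z ≤ 1 ∧ Valued.v (z - ρ z) ≤ Valued.v (ϖE ^ j * (α - ρ α))) ∧ x = x₀ * z) ∧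
        (Valued.v (h * (x₀ * Θ x₀) * (ϖE ^ j * (α - ρ α))) ≤ 1 ∧
            Valued.v (h * (x₀ * Θ x₀) * (ϖE ^ j * (α - ρ α)) - ρ (h * (x₀ * Θ x₀) * (ϖE ^ j * (α - ρ α)))) ≤ Valued.v (ϖE ^ j * (α - ρ α))) ∧
          ¬ (Valued.v (h * (x₀ * Θ x₀) * (ϖE ^ j * (α - ρ α)) / ϖE) ≤ 1 ∧
              Valued.v (h * (x₀ * Θ x₀) * (ϖE ^ j * (α - ρ α)) / ϖE - ρ (h * (x₀ * Θ x₀) * (ϖE ^ j * (α - ρ α)) / ϖE)) ≤ Valued.v (ϖE ^ j * (α - ρ α))) ∧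
            Valued.v (h * (x₀ * Θ x₀) * (ϖE ^ j * (α - ρ α))) = Valued.v ϖE ^ (0 : ℕ)}.ncard = H.relIndex B := by
  obtain ⟨hα0, -⟩ := ne_zero_and_v_zpow_of_v_eq hα 0
  have hη1 := v_classMult_eq_one (Θ := Θ) hvρ hvΘ hh hα0 k₀
  have hA := ncard_setOf_orderLattice_eq_ncard_image_mk hvρ hH (fun x₀ : Kˣ =>
    ((Valued.v (h * ((x₀ : K) * Θ x₀) * (ϖE ^ j * (α - ρ α))) ≤ 1 ∧
          Valued.v (h * ((x₀ : K) * Θ x₀) * (ϖE ^ j * (α - ρ α)) - ρ (h * ((x₀ : K) * Θ x₀) * (ϖE ^ j * (α - ρ α)))) ≤ Valued.v (ϖE ^ j * (α - ρ α))) ∧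
        ¬ (Valued.v (h * ((x₀ : K) * Θ x₀) * (ϖE ^ j * (α - ρ α)) / ϖE) ≤ 1 ∧
            Valued.v (h * ((x₀ : K) * Θ x₀) * (ϖE ^ j * (α - ρ α)) / ϖE - ρ (h * ((x₀ : K) * Θ x₀) * (ϖE ^ j * (α - ρ α)) / ϖE)) ≤ Valued.v (ϖE ^ j * (α - ρ α)))) ∧
      Valued.v (h * ((x₀ : K) * Θ x₀) * (ϖE ^ j * (α - ρ α))) = Valued.v ϖE ^ (0 : ℕ))
  have hsets : {Λ : AddSubgroup K | ∃ x₀ : K, x₀ ≠ 0 ∧ (∀ x, x ∈ Λ ↔ ∃ z, (Valued.v z ≤ 1 ∧ Valued.v (z - ρ z) ≤ Valued.v (ϖE ^ j * (α - ρ α))) ∧ x = x₀ * z) ∧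
        (Valued.v (h * (x₀ * Θ x₀) * (ϖE ^ j * (α - ρ α))) ≤ 1 ∧
            Valued.v (h * (x₀ * Θ x₀) * (ϖE ^ j * (α - ρ α)) - ρ (h * (x₀ * Θ x₀) * (ϖE ^ j * (α - ρ α)))) ≤ Valued.v (ϖE ^ j * (α - ρ α))) ∧
          ¬ (Valued.v (h * (x₀ * Θ x₀) * (ϖE ^ j * (α - ρ α)) / ϖE) ≤ 1 ∧
              Valued.v (h * (x₀ * Θ x₀) * (ϖE ^ j * (α - ρ α)) / ϖE - ρ (h * (x₀ * Θ x₀) * (ϖE ^ j * (α - ρ α)) / ϖE)) ≤ Valued.v (ϖE ^ j * (α - ρ α))) ∧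
            Valued.v (h * (x₀ * Θ x₀) * (ϖE ^ j * (α - ρ α))) = Valued.v ϖE ^ (0 : ℕ)} =
      {Λ : AddSubgroup K | ∃ x₀ : Kˣ,
        (((Valued.v (h * ((x₀ : K) * Θ x₀) * (ϖE ^ j * (α - ρ α))) ≤ 1 ∧
          Valued.v (h * ((x₀ : K) * Θ x₀) * (ϖE ^ j * (α - ρ α)) - ρ (h * ((x₀ : K) * Θ x₀) * (ϖE ^ j * (α - ρ α)))) ≤ Valued.v (ϖE ^ j * (α - ρ α))) ∧
        ¬ (Valued.v (h * ((x₀ : K) * Θ x₀) * (ϖE ^ j * (α - ρ α)) / ϖE) ≤ 1 ∧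
            Valued.v (h * ((x₀ : K) * Θ x₀) * (ϖE ^ j * (α - ρ α)) / ϖE - ρ (h * ((x₀ : K) * Θ x₀) * (ϖE ^ j * (α - ρ α)) / ϖE)) ≤ Valued.v (ϖE ^ j * (α - ρ α)))) ∧
      Valued.v (h * ((x₀ : K) * Θ x₀) * (ϖE ^ j * (α - ρ α))) = Valued.v ϖE ^ (0 : ℕ)) ∧
        ∀ x, x ∈ Λ ↔ ∃ y, (Valued.v y ≤ 1 ∧ Valued.v (y - ρ y) ≤ Valued.v (ϖE ^ j * (α - ρ α))) ∧ x = (x₀ : K) * y} := by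
    ext Λ
    simp only [Set.mem_setOf_eq]
    constructor
    · rintro ⟨x₀, hx₀, hmem, hP1, hP2, hL⟩; exact ⟨Units.mk0 x₀ hx₀, ⟨⟨hP1, hP2⟩, hL⟩, hmem⟩
    · rintro ⟨x₀, ⟨⟨hP1, hP2⟩, hL⟩, hmem⟩; exact ⟨(x₀ : K), x₀.ne_zero, hmem, hP1, hP2, hL⟩
  rw [hsets, hA, setOf_levelGenR_eq_smul_zero hρρ hvΘ hfix hρα hα hdρ hϖE hρϖ hα0 hh hvh j hk₀, ncard_image_mk_smul,
    setOf_v_one_add_mul_twist_le_eq_smul_of_met hvρ hvΘ hη1 hω₁ _ hle hB, ncard_image_mk_smul_subgroup]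

/-- **THE COUNT, `a = 0`, CLASS NOT MET**: no unit meets the class at depth `exp(−(2j + d_ρ))` ⇒ count `0`. [cite: Flicker1998UnitaryFL, p. 84] -/
theorem ncard_levelSetR_zero_eq_zero_of_forall_not (hρρ : ∀ x, ρ (ρ x) = x) (hvρ : ∀ x, Valued.v (ρ x) = Valued.v x) (hvΘ : ∀ x, Valued.v (Θ x) = Valued.v x)
    (hfix : ∀ c : K, ρ c = c → c ≠ 0 → ∃ n : ℤ, Valued.v c = exp (2 * n)) (hρα : ρ α ≠ α)
    (hα : Valued.v α = exp (-1 : ℤ)) (hdρ : Valued.v (α - ρ α) = exp (-(dρ : ℤ))) (hϖE : Valued.v ϖE = exp (-2 : ℤ)) (hρϖ : ρ ϖE = ϖE)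
    (hh : h ≠ 0) {vh : ℤ} (hvh : Valued.v h = exp (-vh)) (j : ℕ) {k₀ : ℤ} (hk₀ : vh + dρ + 2 * k₀ + 2 * j = 0)
    (hnone : ∀ ω : Kˣ, Valued.v (ω : K) = 1 → ¬ Valued.v (1 + (ρ h / h * (ρ (α ^ k₀ * Θ (α ^ k₀)) / (α ^ k₀ * Θ (α ^ k₀)))) * (ρ ((ω : K) * Θ ω) / ((ω : K) * Θ ω))) ≤ exp (-(2 * (j : ℤ) + dρ)))
    (H : Subgroup Kˣ) (hH : ∀ u : Kˣ, u ∈ H ↔ Valued.v (u : K) = 1 ∧ Valued.v ((u : K) - ρ u) ≤ Valued.v (ϖE ^ j * (α - ρ α))) :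
    {Λ : AddSubgroup K | ∃ x₀ : K, x₀ ≠ 0 ∧ (∀ x, x ∈ Λ ↔ ∃ z, (Valued.v z ≤ 1 ∧ Valued.v (z - ρ z) ≤ Valued.v (ϖE ^ j * (α - ρ α))) ∧ x = x₀ * z) ∧
        (Valued.v (h * (x₀ * Θ x₀) * (ϖE ^ j * (α - ρ α))) ≤ 1 ∧
            Valued.v (h * (x₀ * Θ x₀) * (ϖE ^ j * (α - ρ α)) - ρ (h * (x₀ * Θ x₀) * (ϖE ^ j * (α - ρ α)))) ≤ Valued.v (ϖE ^ j * (α - ρ α))) ∧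
          ¬ (Valued.v (h * (x₀ * Θ x₀) * (ϖE ^ j * (α - ρ α)) / ϖE) ≤ 1 ∧
              Valued.v (h * (x₀ * Θ x₀) * (ϖE ^ j * (α - ρ α)) / ϖE - ρ (h * (x₀ * Θ x₀) * (ϖE ^ j * (α - ρ α)) / ϖE)) ≤ Valued.v (ϖE ^ j * (α - ρ α))) ∧
            Valued.v (h * (x₀ * Θ x₀) * (ϖE ^ j * (α - ρ α))) = Valued.v ϖE ^ (0 : ℕ)}.ncard = 0 := by
  obtain ⟨hα0, -⟩ := ne_zero_and_v_zpow_of_v_eq hα 0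
  have hA := ncard_setOf_orderLattice_eq_ncard_image_mk hvρ hH (fun x₀ : Kˣ =>
    ((Valued.v (h * ((x₀ : K) * Θ x₀) * (ϖE ^ j * (α - ρ α))) ≤ 1 ∧
          Valued.v (h * ((x₀ : K) * Θ x₀) * (ϖE ^ j * (α - ρ α)) - ρ (h * ((x₀ : K) * Θ x₀) * (ϖE ^ j * (α - ρ α)))) ≤ Valued.v (ϖE ^ j * (α - ρ α))) ∧
        ¬ (Valued.v (h * ((x₀ : K) * Θ x₀) * (ϖE ^ j * (α - ρ α)) / ϖE) ≤ 1 ∧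
            Valued.v (h * ((x₀ : K) * Θ x₀) * (ϖE ^ j * (α - ρ α)) / ϖE - ρ (h * ((x₀ : K) * Θ x₀) * (ϖE ^ j * (α - ρ α)) / ϖE)) ≤ Valued.v (ϖE ^ j * (α - ρ α)))) ∧
      Valued.v (h * ((x₀ : K) * Θ x₀) * (ϖE ^ j * (α - ρ α))) = Valued.v ϖE ^ (0 : ℕ))
  have hsets : {Λ : AddSubgroup K | ∃ x₀ : K, x₀ ≠ 0 ∧ (∀ x, x ∈ Λ ↔ ∃ z, (Valued.v z ≤ 1 ∧ Valued.v (z - ρ z) ≤ Valued.v (ϖE ^ j * (α - ρ α))) ∧ x = x₀ * z) ∧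
        (Valued.v (h * (x₀ * Θ x₀) * (ϖE ^ j * (α - ρ α))) ≤ 1 ∧
            Valued.v (h * (x₀ * Θ x₀) * (ϖE ^ j * (α - ρ α)) - ρ (h * (x₀ * Θ x₀) * (ϖE ^ j * (α - ρ α)))) ≤ Valued.v (ϖE ^ j * (α - ρ α))) ∧
          ¬ (Valued.v (h * (x₀ * Θ x₀) * (ϖE ^ j * (α - ρ α)) / ϖE) ≤ 1 ∧
              Valued.v (h * (x₀ * Θ x₀) * (ϖE ^ j * (α - ρ α)) / ϖE - ρ (h * (x₀ * Θ x₀) * (ϖE ^ j * (α - ρ α)) / ϖE)) ≤ Valued.v (ϖE ^ j * (α - ρ α))) ∧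
            Valued.v (h * (x₀ * Θ x₀) * (ϖE ^ j * (α - ρ α))) = Valued.v ϖE ^ (0 : ℕ)} =
      {Λ : AddSubgroup K | ∃ x₀ : Kˣ,
        (((Valued.v (h * ((x₀ : K) * Θ x₀) * (ϖE ^ j * (α - ρ α))) ≤ 1 ∧
          Valued.v (h * ((x₀ : K) * Θ x₀) * (ϖE ^ j * (α - ρ α)) - ρ (h * ((x₀ : K) * Θ x₀) * (ϖE ^ j * (α - ρ α)))) ≤ Valued.v (ϖE ^ j * (α - ρ α))) ∧
        ¬ (Valued.v (h * ((x₀ : K) * Θ x₀) * (ϖE ^ j * (α - ρ α)) / ϖE) ≤ 1 ∧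
            Valued.v (h * ((x₀ : K) * Θ x₀) * (ϖE ^ j * (α - ρ α)) / ϖE - ρ (h * ((x₀ : K) * Θ x₀) * (ϖE ^ j * (α - ρ α)) / ϖE)) ≤ Valued.v (ϖE ^ j * (α - ρ α)))) ∧
      Valued.v (h * ((x₀ : K) * Θ x₀) * (ϖE ^ j * (α - ρ α))) = Valued.v ϖE ^ (0 : ℕ)) ∧
        ∀ x, x ∈ Λ ↔ ∃ y, (Valued.v y ≤ 1 ∧ Valued.v (y - ρ y) ≤ Valued.v (ϖE ^ j * (α - ρ α))) ∧ x = (x₀ : K) * y} := by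
    ext Λ
    simp only [Set.mem_setOf_eq]
    constructor
    · rintro ⟨x₀, hx₀, hmem, hP1, hP2, hL⟩; exact ⟨Units.mk0 x₀ hx₀, ⟨⟨hP1, hP2⟩, hL⟩, hmem⟩
    · rintro ⟨x₀, ⟨⟨hP1, hP2⟩, hL⟩, hmem⟩; exact ⟨(x₀ : K), x₀.ne_zero, hmem, hP1, hP2, hL⟩
  rw [hsets, hA, setOf_levelGenR_eq_smul_zero hρρ hvΘ hfix hρα hα hdρ hϖE hρϖ hα0 hh hvh j hk₀, ncard_image_mk_smul,
    setOf_v_one_add_mul_twist_le_eq_empty _ hnone, Set.image_empty, Set.ncard_empty]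


end Literature.NumberTheory.LocalFields.QuadraticOrder
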